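import Summits.CriticalPhenomena.PercolationContinuityZ3.Theses.PercNecklaceBackbone
import Summits.CriticalPhenomena.PercolationContinuityZ3.Theses.PercTruncatedSusceptibility
import Summits.CriticalPhenomena.PercolationContinuityZ3.Theses.PercAntiMeanFieldOnset
import Summits.CriticalPhenomena.PercolationContinuityZ3.Theorems.PercNecklaceBackboneTruncatedSusceptibilityFiniteOfThetaStubSupercriticalRadiusMoment
import Summits.CriticalPhenomena.PercolationContinuityZ3.Theorems.PercNecklaceBackboneTruncatedSusceptibilityFiniteOfThetaStubChiFiniteOfRadiusMoment
import Literature.Probability.Percolation.BernoulliPercolationProofs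
import HarnessLib

/-!
# The crux `TruncatedSusceptibilityFiniteOfTheta` (stmt-CriticalPhenomena-0852) is equivalent to its live case `p = p_c`

Crux L of `PercolationContinuityZ3` (shared verbatim by the routes `PercNecklaceBackbone` (r4),
`PercTruncatedSusceptibility` (r3) and `PercAntiMeanFieldOnset` (r3)):
`∀ p, θ_{ℤ³}(p) > 0 → Σ_x P_p(0 ↔ x, |C(0)| < ∞) < ∞`.

With the two landed stubs of the lead's line `Cruxes/TruncatedSusceptibilityFiniteOfTheta/Lines/birth.lean`
(`stub_supercriticalRadiusMoment`: finite second radius shell-moment of finite clusters for `p > p_c`, from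
the discharged Duminil-Copin–Kozma–Tassion 2020 Thm 2; `stub_chiFiniteOfRadiusMoment`: volume from radius at
every `p`) the whole supercritical regime `p > p_c` of L is a theorem (`summable_truncated_of_criticalProb_lt`),
and since `θ(p) > 0` forces `p_c ≤ p` (`criticalProb_le_of_theta_pos`), the crux is EQUIVALENT to its single
hypothetical instance at the critical point (`TruncatedSusceptibilityFiniteOfTheta_iff_critical`):

  L ⟺ ( θ(p_c) > 0 → Σ_x P_{p_c}(0 ↔ x, |C(0)| < ∞) < ∞ ),

and is implied by the registered open stub `stub_criticalRadiusMoment` (radius form at `p_c`,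
`TruncatedSusceptibilityFiniteOfTheta_of_criticalRadiusMoment`). No new definitions; no named-fact hypothesis.
-/

noncomputable section

namespace Summit.CriticalPhenomena.PercolationContinuityZ3.Theorems.TruncatedSusceptibilityFiniteOfTheta

open MeasureTheory Literature.Probability.Percolation Literature.Probability.LatticeModels

/-- `θ(p) > 0 ⇒ p_c ≤ p` on `ℤ³` (`p_c = inf ({p | θ(p) > 0} ∪ {1})`, Grimmett 1999 (1.11)). -/
theorem criticalProb_le_of_theta_pos {p : unitInterval} (h : 0 < theta (zdGraph 3) (0 : Site 3) p) :
    criticalProb (zdGraph 3) (0 : Site 3) ≤ (p : ℝ) := by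
  refine csInf_le ⟨0, ?_⟩ (Or.inl ⟨p.2, by simpa using h⟩)
  rintro r (⟨hr, -⟩ | hr)
  · exact hr.1
  · rw [Set.mem_singleton_iff] at hr
    rw [hr]; exact zero_le_one

/-- The regime split: a percolating `p` of `ℤ³` is either the critical point `criticalProbI 3` itself or
strictly supercritical. -/
theorem eq_criticalProbI_or_criticalProb_lt {p : unitInterval} (h : 0 < theta (zdGraph 3) (0 : Site 3) p) :
    p = criticalProbI 3 ∨ criticalProb (zdGraph 3) (0 : Site 3) < (p : ℝ) := by
  rcases (criticalProb_le_of_theta_pos h).eq_or_lt with heq | hlt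
  · exact Or.inl (Subtype.ext (by rw [coe_criticalProbI]; exact heq.symm))
  · exact Or.inr hlt

/-- **The supercritical regime of L is a theorem**: for `p > p_c(ℤ³)`, `Σ_x P_p(0 ↔ x, |C(0)| < ∞) < ∞`
(Grimmett 1999 Thm (8.21) + (8.51); here STUB 3 ∘ STUB 1 of the line). -/
theorem summable_truncated_of_criticalProb_lt (p : unitInterval)
    (hp : criticalProb (zdGraph 3) (0 : Site 3) < (p : ℝ)) :
    Summable fun x : Site 3 => (bondPercolation (zdGraph 3) p).real (openConn 0 x \ percolatesAt 0) :=
  stub_chiFiniteOfRadiusMoment p (stub_supercriticalRadiusMoment p hp)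

/-- **Reduction of the crux to its live case.** If the single hypothetical instance at `p_c` holds
(`θ(p_c) > 0 ⇒ χᶠ(p_c) < ∞`), then L holds at every percolating `p`. -/
theorem TruncatedSusceptibilityFiniteOfTheta_of_critical
    (hcrit : 0 < theta (zdGraph 3) (0 : Site 3) (criticalProbI 3) →
      Summable fun x : Site 3 =>
        (bondPercolation (zdGraph 3) (criticalProbI 3)).real (openConn 0 x \ percolatesAt 0)) :
    Summit.CriticalPhenomena.PercolationContinuityZ3.Theses.PercNecklaceBackbone.TruncatedSusceptibilityFiniteOfTheta := by
  intro p hθ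
  rcases eq_criticalProbI_or_criticalProb_lt hθ with rfl | hlt
  · exact hcrit hθ
  · exact summable_truncated_of_criticalProb_lt p hlt

/-- **L ⟺ L(p_c)**: the crux is equivalent to its instance at the critical point. -/
theorem TruncatedSusceptibilityFiniteOfTheta_iff_critical :
    Summit.CriticalPhenomena.PercolationContinuityZ3.Theses.PercNecklaceBackbone.TruncatedSusceptibilityFiniteOfTheta ↔
      (0 < theta (zdGraph 3) (0 : Site 3) (criticalProbI 3) →
        Summable fun x : Site 3 =>
          (bondPercolation (zdGraph 3) (criticalProbI 3)).real (openConn 0 x \ percolatesAt 0)) :=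
  ⟨fun h hθ => h (criticalProbI 3) hθ, TruncatedSusceptibilityFiniteOfTheta_of_critical⟩

/-- **The crux from the open stub** `stub_criticalRadiusMoment` (radius form of the live case: at a
percolating `p_c` the finite-cluster one-arm probabilities have a finite second shell moment), through the
landed volume-from-radius stub. -/
theorem TruncatedSusceptibilityFiniteOfTheta_of_criticalRadiusMoment
    (hrad : 0 < theta (zdGraph 3) (0 : Site 3) (criticalProbI 3) →
      Summable fun n : ℕ => ((n : ℝ) + 1) ^ 2 *
        (bondPercolation (zdGraph 3) (criticalProbI 3)).real (siteToBoundary 3 n \ percolatesAt 0)) :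
    Summit.CriticalPhenomena.PercolationContinuityZ3.Theses.PercNecklaceBackbone.TruncatedSusceptibilityFiniteOfTheta :=
  TruncatedSusceptibilityFiniteOfTheta_of_critical fun hθ => stub_chiFiniteOfRadiusMoment _ (hrad hθ)

/-- **Crux r4 ⇒ crux r3** (route `PercTruncatedSusceptibility`: "`FiniteRadiusExpDecayOfTheta` implies L"):
exponential radius decay of finite clusters at every percolating `p` (item stmt-CriticalPhenomena-0853)
gives, at `p = p_c`, the finite second shell moment of the open stub (`Σ (n+1)² e^{−cn} < ∞`,
`StubSupercriticalRadiusMoment.summable_sq_mul_exp_neg`), hence the crux. -/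
theorem TruncatedSusceptibilityFiniteOfTheta_of_FiniteRadiusExpDecayOfTheta
    (h : Summit.CriticalPhenomena.PercolationContinuityZ3.Theses.PercTruncatedSusceptibility.FiniteRadiusExpDecayOfTheta) :
    Summit.CriticalPhenomena.PercolationContinuityZ3.Theses.PercNecklaceBackbone.TruncatedSusceptibilityFiniteOfTheta := by
  refine TruncatedSusceptibilityFiniteOfTheta_of_criticalRadiusMoment fun hθ => ?_
  obtain ⟨c, hc, hle⟩ := h (criticalProbI 3) hθ
  refine (StubSupercriticalRadiusMoment.summable_sq_mul_exp_neg hc).of_nonneg_of_le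
    (fun n => mul_nonneg (by positivity) measureReal_nonneg) fun n => ?_
  exact mul_le_mul_of_nonneg_left (hle n) (by positivity)

/-- The same reduction for the home-route spelling of the shared crux (`PercTruncatedSusceptibility`, r3). -/
theorem TruncatedSusceptibilityFiniteOfTheta_of_critical'
    (hcrit : 0 < theta (zdGraph 3) (0 : Site 3) (criticalProbI 3) →
      Summable fun x : Site 3 =>
        (bondPercolation (zdGraph 3) (criticalProbI 3)).real (openConn 0 x \ percolatesAt 0)) :
    Summit.CriticalPhenomena.PercolationContinuityZ3.Theses.PercTruncatedSusceptibility.TruncatedSusceptibilityFiniteOfTheta :=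
  TruncatedSusceptibilityFiniteOfTheta_of_critical hcrit

/-- The same reduction for the `PercAntiMeanFieldOnset` spelling of the shared crux (r3). -/
theorem TruncatedSusceptibilityFiniteOfTheta_of_critical''
    (hcrit : 0 < theta (zdGraph 3) (0 : Site 3) (criticalProbI 3) →
      Summable fun x : Site 3 =>
        (bondPercolation (zdGraph 3) (criticalProbI 3)).real (openConn 0 x \ percolatesAt 0)) :
    Summit.CriticalPhenomena.PercolationContinuityZ3.Theses.PercAntiMeanFieldOnset.TruncatedSusceptibilityFiniteOfTheta :=
  TruncatedSusceptibilityFiniteOfTheta_of_critical hcrit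

end Summit.CriticalPhenomena.PercolationContinuityZ3.Theorems.TruncatedSusceptibilityFiniteOfTheta

end
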